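import Summits.Ventures.Crystal3D.Theorems.StickyWulffConstantGenericWallFloorDoubleTopLocalFrame
import Summits.Ventures.Crystal3D.Theorems.StickyWulffConstantCoaxialWallLawTwinWord
import Summits.Ventures.Crystal3D.Theorems.StickyWulffConstantCoaxialWallLawExitsBelow
import Summits.Ventures.Crystal3D.Theorems.StickyWulffConstantNoReconstructionGainCubicActions
import HarnessLib

/-!
# Double tops, local part 5: the reference rotation of a certificate is co-axial
# (crux `GenericWallFloor`, line `WallLedgerG`, residual `#DT₁₁`; local half of R39d «DoubleStarFree»)

HONEST FRAMING. Part of the venture `Summits/Ventures/Crystal3D` (cell `crystal3d-full`), helper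
`--supports` the crux `GenericWallFloor` (stmt-Ventures-19480) of `route-Ventures-StickyWulffConstant`,
registered line `WallLedgerG`, open stub `stub_twoSlabAdhesion`.  `…DoubleTopLocalFrame` concludes
`cubicMat R = B` (the relative rotation equals the certificate's reference rotation); this file turns that
into the CO-AXIALITY clause of the wall cruxes in the frame form of `coaxial_iff_common_frame`:
`∃ L, (Λ₀ = L·Λ₀ ∨ Λ₀ = L·Λ₀⁻) ∧ (R·Λ₀ = L·Λ₀ ∨ R·Λ₀ = L·Λ₀⁻)`, `Λ₀⁻ = B(−1)`.

* `cubicMat_trans / _refl / _symm`, `cubicMat_bondReflection` (`1 − s sᵀ` for the bond mirror of the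
  slot with cubic vector `s`), `cubicMat_halfTurn` (the half-turn about the basal axis `e₃` of the tree's
  coordinates — whose image of `Λ₀` is `Λ₀⁻`, `barlowStacking_negConst_eq_halfTurn_image` — has cubic
  matrix `halfTurnQ = 2nnᵀ − 1`, `n = (−1,1,1)/√3`);
* `PermSlots G` (decidable): the rational matrix `G` maps the twelve slot vectors to slot vectors;
  `image_fcc_eq_of_permSlots` — then an isometry with cubic matrix `G` satisfies `R·Λ₀ = Λ₀`;
* **`coaxial_of_cubicMat_lattice`** — `cubicMat R = G`, `PermSlots G` ⇒ the clause with `L = 1`;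
* **`coaxial_of_cubicMat_twin`** — `cubicMat R = G`, `PermSlots (H · (1 − s sᵀ) · G)` for a slot `s`
  ⇒ the clause with `L` = the bond mirror of `s` (then `R = r_s ∘ H ∘ g` with `g·Λ₀ = Λ₀`, so
  `R·Λ₀ = r_s·Λ₀⁻`).
The per-certificate checks `PermSlots …` are `decide`d in the atlas file.

WHAT THIS IS NOT: the slot normalisation `u₁, u₂ ↦ slotSite 0`, the assembly with the interval half
(R39d), the ledger glue; rung F-C1 not moved.
-/

noncomputable section

namespace Summit.Ventures.Crystal3D.Theorems

open Matrix NearIdentity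
open Literature.MathematicalPhysics.StatisticalMechanics (fccStacking barlowStacking barlowPos constHagg)
open scoped InnerProductSpace

/-! ### Algebra of `cubicMat` -/

/-- `cubicMat (R ≫ S) = cubicMat S · cubicMat R`. -/
theorem cubicMat_trans (R S : EuclideanSpace ℝ (Fin 3) ≃ₗᵢ[ℝ] EuclideanSpace ℝ (Fin 3)) :
    cubicMat (R.trans S) = cubicMat S * cubicMat R := by
  ext i j
  rw [Matrix.mul_apply]
  change cubicCoords (S (R (cubicFrame j))) i = _
  rw [cubicCoords_eq_cubicMat_mulVec S]
  simp only [Matrix.mulVec, dotProduct, cubicMat, Matrix.of_apply]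

/-- `cubicMat 1 = 1`. -/
theorem cubicMat_refl : cubicMat (LinearIsometryEquiv.refl ℝ (EuclideanSpace ℝ (Fin 3))) = 1 := by
  ext i j
  simp only [cubicMat, Matrix.of_apply, LinearIsometryEquiv.coe_refl, id_eq, cubicCoords_cubicFrame,
    Matrix.one_apply, Pi.single_apply]

/-- `cubicMat R⁻¹ = (cubicMat R)ᵀ`. -/
theorem cubicMat_symm (R : EuclideanSpace ℝ (Fin 3) ≃ₗᵢ[ℝ] EuclideanSpace ℝ (Fin 3)) :
    cubicMat R.symm = (cubicMat R)ᵀ := by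
  have h : cubicMat R * cubicMat R.symm = 1 := by
    rw [← cubicMat_trans, LinearIsometryEquiv.symm_trans_self, cubicMat_refl]
  calc cubicMat R.symm = ((cubicMat R)ᵀ * cubicMat R) * cubicMat R.symm := by rw [cubicMat_orth, Matrix.one_mul]
    _ = (cubicMat R)ᵀ := by rw [Matrix.mul_assoc, h, Matrix.mul_one]

/-- Real cast of a rational `3 × 3` matrix. -/
def castMat (G : Fin 3 → Fin 3 → ℚ) : Matrix (Fin 3) (Fin 3) ℝ := Matrix.of fun i j => ((G i j : ℚ) : ℝ)

/-- Rational matrix product (spelled out). -/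
def mulMatQ (G H : Fin 3 → Fin 3 → ℚ) : Fin 3 → Fin 3 → ℚ :=
  fun i j => G i 0 * H 0 j + G i 1 * H 1 j + G i 2 * H 2 j

/-- `castMat (G·H) = castMat G · castMat H`. -/
theorem castMat_mulMatQ (G H : Fin 3 → Fin 3 → ℚ) : castMat (mulMatQ G H) = castMat G * castMat H := by
  ext i j
  rw [Matrix.mul_apply]
  simp only [castMat, mulMatQ, Matrix.of_apply, Fin.sum_univ_three]
  push_cast; ring

/-- The bond mirror of slot `m`, as a rational matrix: `1 − s sᵀ`. -/
def mirrorQ (m : Fin 12) : Fin 3 → Fin 3 → ℚ :=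
  fun i j => (if i = j then 1 else 0) - (slotInt m i : ℚ) * (slotInt m j : ℚ)

/-- The half-turn about the tree's basal axis, as a rational matrix: `2nnᵀ − 1`, `n = (−1,1,1)/√3`. -/
def halfTurnQ : Fin 3 → Fin 3 → ℚ :=
  ![![(-1 : ℚ) / 3, (-2 : ℚ) / 3, (-2 : ℚ) / 3], ![(-2 : ℚ) / 3, (-1 : ℚ) / 3, (2 : ℚ) / 3],
    ![(-2 : ℚ) / 3, (2 : ℚ) / 3, (-1 : ℚ) / 3]]

/-- `mirrorQ m` is symmetric. -/
theorem castMat_mirrorQ_transpose (m : Fin 12) : (castMat (mirrorQ m))ᵀ = castMat (mirrorQ m) := by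
  ext i j
  simp only [castMat, Matrix.transpose_apply, Matrix.of_apply, mirrorQ]
  push_cast
  by_cases h : i = j
  · subst h; simp
  · rw [if_neg h, if_neg (Ne.symm h)]; ring

/-- `halfTurnQ` is symmetric. -/
theorem castMat_halfTurnQ_transpose : (castMat halfTurnQ)ᵀ = castMat halfTurnQ := by
  ext i j
  simp only [castMat, Matrix.transpose_apply, Matrix.of_apply, halfTurnQ]
  fin_cases i <;> fin_cases j <;> simp

/-- **Cubic matrix of a bond mirror**: `1 − s sᵀ`. -/
theorem cubicMat_bondReflection (m : Fin 12) :
    cubicMat ((ℝ ∙ slotSite m)ᗮ.reflection) = castMat (mirrorQ m) := by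
  have hw : ‖slotSite m‖ = 1 := norm_eq_one_of_mem_fccSlots (slotSite_mem m)
  have hs : Real.sqrt 2 ^ 2 = 2 := Real.sq_sqrt (by norm_num)
  have hs0 : Real.sqrt 2 ≠ 0 := by positivity
  ext i j
  simp only [cubicMat, castMat, mirrorQ, Matrix.of_apply]
  rw [bondReflection_apply _ _ hw, cubicCoords_sub, cubicCoords_smul, inner_cubicFrame, cubicCoords_slotSite,
    cubicCoords_cubicFrame]
  simp only [Pi.sub_apply, Pi.smul_apply, Pi.single_apply, smul_eq_mul, slotVec]
  push_cast
  split_ifs <;> field_simp <;> rw [hs] <;> ring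

/-- **Cubic matrix of the half-turn about `e₃`**: `halfTurnQ`. -/
theorem cubicMat_halfTurn :
    cubicMat ((ℝ ∙ EuclideanSpace.single (2 : Fin 3) (1 : ℝ)).reflection) = castMat halfTurnQ := by
  have hs : Real.sqrt 2 ^ 2 = 2 := Real.sq_sqrt (by norm_num)
  have h3 : Real.sqrt 3 ^ 2 = 3 := Real.sq_sqrt (by norm_num)
  have h23 : Real.sqrt (2 / 3) ^ 2 = 2 / 3 := Real.sq_sqrt (by norm_num)
  have hs0 : Real.sqrt 2 ≠ 0 := by positivity
  have h30 : Real.sqrt 3 ≠ 0 := by positivity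
  have h23' : Real.sqrt (2 / 3) * Real.sqrt 3 = Real.sqrt 2 := by
    rw [← Real.sqrt_mul (by norm_num)]; norm_num
  ext i j
  simp only [cubicMat, castMat, Matrix.of_apply]
  rw [halfTurn_apply, cubicCoords_sub, cubicCoords_smul, cubicCoords_cubicFrame]
  fin_cases i <;> fin_cases j <;>
    simp [cubicCoords, cubicFrame, halfTurnQ] <;> field_simp <;> nlinarith [hs, h3, h23, h23']

/-! ### Slot permutations -/

/-- Slot `k` as a rational vector. -/
def slotQ (k : Fin 12) : Fin 3 → ℚ := fun l => slotInt k l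

/-- `G` maps the twelve slot vectors to slot vectors (decidable). -/
def PermSlots (G : Fin 3 → Fin 3 → ℚ) : Prop := ∀ k : Fin 12, ∃ k' : Fin 12, DTCert.mulQ G (slotQ k) = slotQ k'

/-- `PermSlots` is decidable. -/
instance (G : Fin 3 → Fin 3 → ℚ) : Decidable (PermSlots G) := by unfold PermSlots; infer_instance

/-- `castMat G · slotVec k = (G · slotInt k)/√2`. -/
theorem castMat_mulVec_slotVec (G : Fin 3 → Fin 3 → ℚ) (k : Fin 12) :
    castMat G *ᵥ slotVec k = fun i => ((DTCert.mulQ G (slotQ k) i : ℚ) : ℝ) / Real.sqrt 2 := by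
  ext i
  simp only [Matrix.mulVec, dotProduct, Fin.sum_univ_three, castMat, Matrix.of_apply, slotVec, DTCert.mulQ,
    slotQ]
  push_cast; ring

/-- **An isometry whose cubic matrix permutes the slots preserves `Λ₀`.** -/
theorem image_fcc_eq_of_permSlots (R : EuclideanSpace ℝ (Fin 3) ≃ₗᵢ[ℝ] EuclideanSpace ℝ (Fin 3))
    {G : Fin 3 → Fin 3 → ℚ} (hR : cubicMat R = castMat G) (hG : PermSlots G) :
    R '' fccStacking 1 (Real.sqrt (2 / 3)) = fccStacking 1 (Real.sqrt (2 / 3)) := by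
  have key : ∀ w ∈ fccSlots, R w ∈ (LinearIsometryEquiv.refl ℝ (EuclideanSpace ℝ (Fin 3))) ''
      fccStacking 1 (Real.sqrt (2 / 3)) := by
    intro w hw
    obtain ⟨k, rfl⟩ := exists_slotSite_eq hw
    obtain ⟨k', hk'⟩ := hG k
    have hRk : R (slotSite k) = slotSite k' := by
      apply cubicCoords_injective
      rw [cubicCoords_eq_cubicMat_mulVec, hR, cubicCoords_slotSite, cubicCoords_slotSite, castMat_mulVec_slotVec,
        hk']
      ext i; simp only [slotVec, slotQ, Rat.cast_intCast]
    rw [hRk]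
    exact ⟨slotSite k', mem_fcc_of_mem_fccSlots (slotSite_mem k'), rfl⟩
  have := image_fcc_eq_of_slots_mem R (LinearIsometryEquiv.refl ℝ _) key
  simpa using this

/-! ### The co-axiality clause -/

/-- **Lattice symmetry.**  `cubicMat R = G` with `G` permuting the slots ⇒ the pair `(Λ₀, R·Λ₀)` has the
common frame `L = 1`. -/
theorem coaxial_of_cubicMat_lattice (R : EuclideanSpace ℝ (Fin 3) ≃ₗᵢ[ℝ] EuclideanSpace ℝ (Fin 3))
    {G : Fin 3 → Fin 3 → ℚ} (hR : cubicMat R = castMat G) (hG : PermSlots G) :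
    ∃ L : EuclideanSpace ℝ (Fin 3) ≃ₗᵢ[ℝ] EuclideanSpace ℝ (Fin 3),
      (fccStacking 1 (Real.sqrt (2 / 3)) = L '' fccStacking 1 (Real.sqrt (2 / 3)) ∨
        fccStacking 1 (Real.sqrt (2 / 3)) = L '' barlowStacking 1 (Real.sqrt (2 / 3)) (fun _ : ℤ => (-1 : ℤ))) ∧
      (R '' fccStacking 1 (Real.sqrt (2 / 3)) = L '' fccStacking 1 (Real.sqrt (2 / 3)) ∨
        R '' fccStacking 1 (Real.sqrt (2 / 3)) = L '' barlowStacking 1 (Real.sqrt (2 / 3)) (fun _ : ℤ => (-1 : ℤ))) := by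
  refine ⟨LinearIsometryEquiv.refl ℝ _, Or.inl (by simp), Or.inl ?_⟩
  rw [image_fcc_eq_of_permSlots R hR hG]; simp

/-- **Σ3 twin.**  `cubicMat R = G` and `H · r_m · G` permutes the slots (`H` the basal half-turn, `r_m`
the bond mirror of slot `m`) ⇒ the pair `(Λ₀, R·Λ₀)` has the common frame `L = r_m`, with
`R·Λ₀ = r_m·Λ₀⁻`. -/
theorem coaxial_of_cubicMat_twin (R : EuclideanSpace ℝ (Fin 3) ≃ₗᵢ[ℝ] EuclideanSpace ℝ (Fin 3))
    {G : Fin 3 → Fin 3 → ℚ} (hR : cubicMat R = castMat G) (m : Fin 12)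
    (hG : PermSlots (mulMatQ halfTurnQ (mulMatQ (mirrorQ m) G))) :
    ∃ L : EuclideanSpace ℝ (Fin 3) ≃ₗᵢ[ℝ] EuclideanSpace ℝ (Fin 3),
      (fccStacking 1 (Real.sqrt (2 / 3)) = L '' fccStacking 1 (Real.sqrt (2 / 3)) ∨
        fccStacking 1 (Real.sqrt (2 / 3)) = L '' barlowStacking 1 (Real.sqrt (2 / 3)) (fun _ : ℤ => (-1 : ℤ))) ∧
      (R '' fccStacking 1 (Real.sqrt (2 / 3)) = L '' fccStacking 1 (Real.sqrt (2 / 3)) ∨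
        R '' fccStacking 1 (Real.sqrt (2 / 3)) = L '' barlowStacking 1 (Real.sqrt (2 / 3)) (fun _ : ℤ => (-1 : ℤ))) := by
  set r := (ℝ ∙ slotSite m)ᗮ.reflection with hr
  set Hh := (ℝ ∙ EuclideanSpace.single (2 : Fin 3) (1 : ℝ)).reflection with hH
  -- `g := H⁻¹ ∘ r⁻¹ ∘ R` is a lattice symmetry
  set g := (R.trans r.symm).trans Hh.symm with hg
  have hgmat : cubicMat g = castMat (mulMatQ halfTurnQ (mulMatQ (mirrorQ m) G)) := by
    rw [hg, cubicMat_trans, cubicMat_trans, cubicMat_symm, cubicMat_symm, hR, hH, cubicMat_halfTurn, hr,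
      cubicMat_bondReflection, castMat_mulMatQ, castMat_mulMatQ, castMat_halfTurnQ_transpose,
      castMat_mirrorQ_transpose]
  have hgΛ : g '' fccStacking 1 (Real.sqrt (2 / 3)) = fccStacking 1 (Real.sqrt (2 / 3)) :=
    image_fcc_eq_of_permSlots g hgmat hG
  -- `R = r ∘ H ∘ g`
  have hRg : ∀ x, R x = r (Hh (g x)) := by
    intro x
    simp only [hg, LinearIsometryEquiv.trans_apply, LinearIsometryEquiv.apply_symm_apply]
  have hrΛ : r '' fccStacking 1 (Real.sqrt (2 / 3)) = fccStacking 1 (Real.sqrt (2 / 3)) := by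
    have h := latticeIsometry_bondReflection (mem_fcc_of_mem_fccSlots (slotSite_mem m))
      (norm_eq_one_of_mem_fccSlots (slotSite_mem m))
    apply Set.Subset.antisymm
    · rintro _ ⟨p, hp, rfl⟩; exact h.1 p hp
    · intro p hp; exact ⟨r.symm p, h.2 p hp, r.apply_symm_apply p⟩
  refine ⟨r, Or.inl hrΛ.symm, Or.inr ?_⟩
  rw [barlowStacking_negConst_eq_halfTurn_image, ← hH, Set.image_image]
  have : R '' fccStacking 1 (Real.sqrt (2 / 3)) = (fun x => r (Hh x)) '' (g '' fccStacking 1 (Real.sqrt (2 / 3))) := by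
    rw [Set.image_image]; exact Set.image_congr fun x _ => hRg x
  rw [this, hgΛ]

end Summit.Ventures.Crystal3D.Theorems

end
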